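import Summits.QuantumFields.BalabanUV.T4Continuum.Support.B13CarriersFootprint
import Summits.QuantumFields.BalabanUV.T4Continuum.Support.B13StepTermLabels

/-!
# NE5 ∕ U3, crux O1, row O1-d1 follower (ii) — the `InnerData` OF RECORD for the term labels of [Balaban1988RG2Cluster] §2 on the
# carriers of record `B13Carriers.TwoRuns.carriers` (bonds, cubes of sites, the catalogue one level below, cross-level inclusion)

Cell `pub-balaban`, unit `b2b-balaban-t4-ne5-formalise-leaf-02` (NE5 formalisation swarm, leaf prover 02; row O1-d1 of
`t4/b2b-balaban-t4-ne5-p1/O1-CLAIM-TABLE-NE5-P1.md`; journal l.6075).  Summits-side NEW WORK under the LEAN PLACEMENT RULE (cell modelling;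
nothing of the manuscripts under audit is asserted — [II] = [Balaban1988RG2Cluster] is cited for KIND∕locus only).  HONEST FRAMING: rung
(B)+1 bookkeeping for the FINITE-VOLUME T⁴ programme — NOT the continuum limit by itself, NOT infinite volume, NOT a mass gap, NOT Clay;
NE5 NOT PROVED; spine 0∕9.  HONEST DEPENDENCY (cell line, verbatim): continuum YM on T⁴ ⇐ BetaPertH ∧ nine spine estimates (0/9
proved); BetaPertH ⇐ (D1) ∧ (D4) ∧ CAP+tail; G-an2-4 gates asym, D1 and NE2/3/4.

WHAT THIS FILE DOES.  `B13StepTermLabels` (p207773) types the labels `(Z; Z₀, 𝐃, P)` of the (2.13)∘(2.9)∘Σ_{𝐃,P}(2.14) expansion over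
ANY carriers, given route P2's footprint geometry and a small DATA record `InnerData C Bnd` = {`innerLevel k` (the catalogue 𝐃 of [II]
one level below the output level `k`), `bondsIn Z₀` (unit-lattice bonds inside `Z₀`, where the large-field sets `P` of (2.3) p. 12 live),
`within` (cross-level inclusion, p. 15 *"Y ⊂ Z₀, and Z̃₀ ⊂ Z ⊂ X"*)}.  Here that record is INSTANTIATED on the carriers of record
`R.carriers` of `R : B13Carriers.TwoRuns G` (p207668; `Dom = Σ j, TDom 4 (R.cubesPerDir j)`, `scale = Sigma.fst`):
* §1 `Bnd R := Σ i, PBond (R.F.P R.K) i` — the bonds of ALL levels of run A's lattice family, tagged by level (the two runs share the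
  unit lattice of each paired step, `B13Carriers.sitesPerDir_runA_zero` ∕ `TwoRuns.cubesPerDir_runB`; run A's indexing is the common
  one), with decidable equality; the cube maps are the holder's `B13CarriersFootprint.toCube R i j` (p208379, BY NAME: the cube of
  `π_j` containing a level-`i` site = coordinatewise integer quotient by `L^{j + m′ − i}`); a cube index of level `i` is itself a label
  of level `i + m′`, so the same map COARSENS cube indices: `coarsen R i j := toCube R (i + m′) j`.
* §2 **`b13InnerData R : InnerData R.carriers (Bnd R)`**: `innerLevel k = R.domAt (k − 1)` for `k ≥ 1` and `∅` for `k = 0` ([II] step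
  `k`: potentials `𝐕_k(Y)`, `Y ∈ 𝐃_k`, conditioning domains `Z₀ ∈ 𝐃_k`, output on `𝐃_{k+1}` — one level up); `bondsIn Z₀` = the
  level-`(scale Z₀)` bonds whose two endpoints lie in `Z₀` (`B13CarriersFootprint.sitesAt`∕`bondsAt` BY NAME plus the target condition:
  lattice reading of p. 12 *"bonds of P have to be contained in the interior of Z₀"*); `within Y Z ⟺ scale Y ≤ scale Z ∧ (cubes of Y
  coarsened to Z's level) ⊆ cubes of Z` — NOT footprint inclusion
  (`B13DomainGeometry.Cube R = Σ j, TPt 4 _` tags cubes by their level, so footprints of different levels never meet).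
* §3 bookkeeping: `mem_innerLevel` (`Y ∈ innerLevel k ⟺ 0 < k ∧ scale Y + 1 = k`), `coarsen_self`∕`within_refl` (same level: plain
  inclusion, reflexive), `mem_bondsIn`, `within_iff`.
NO estimate; every `def` is data, every theorem unfolds a definition; imports `B13CarriersFootprint` (hence `B13Carriers`) and
`B13StepTermLabels` BY NAME.  The finite catalogues of (2.13)-labels on Bałaban's lattices are then `B13StepTermLabels.termLabels
(B13DomainGeometry.domainGeometry R) (b13InnerData R) k X n` once the holder's `B13DomainGeometry` (p208264) is in the tree (one line,
for the O1-e assembler).  0 sorry; axioms ⊆ {propext, Classical.choice, Quot.sound}.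
-/

namespace Summit.QuantumFields.BalabanUV.T4Continuum.B13InnerData

open Literature.MathematicalPhysics.QuantumFieldTheory.Balaban1983to89
open Literature.MathematicalPhysics.QuantumFieldTheory.Balaban1983to89.TreeLengthTorus
open Summit.QuantumFields.BalabanUV.T4Continuum.B13Carriers (TwoRuns)
open Summit.QuantumFields.BalabanUV.T4Continuum.B13CarriersFootprint (toCube toCube_apply toCube_self sitesAt bondsAt mem_sitesAt mem_bondsAt)
open Summit.QuantumFields.BalabanUV.T4Continuum.B13StepTermLabels (InnerData)

variable {G : Type} [GaugeGroup G] (R : TwoRuns G)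

/-! ## §1 Bonds of all levels; the cube of a site; coarsening of cube indices -/

/-- [folklore] Decidable equality of positively oriented bonds (a bond is its source and direction). -/
instance instDecidableEqPBond (P : Params) (j : ℕ) : DecidableEq (PBond P j) := fun a b =>
  decidable_of_iff (a.src = b.src ∧ a.dir = b.dir)
    ⟨fun h => by cases a; cases b; cases h.1; cases h.2; rfl, fun h => by subst h; exact ⟨rfl, rfl⟩⟩

/-- [folklore] THE BOND TYPE of the labels: positively oriented bonds of every level of run A's lattice family, tagged by the level
(the unit lattice of the step with output level `k` is level `k − 1`). -/
abbrev Bnd : Type := Σ i : ℕ, PBond (R.F.P R.K) i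

/-- [folklore] COARSENING of cube indices from level `i` to level `j ≥ i`: a cube index of level `i` is a label of level `i + m′`,
and its cube of `π_j` is the holder's `toCube R (i + m′) j` (quotient by `L^{j − i}`). -/
def coarsen (i j : ℕ) (a : TPt 4 (R.cubesPerDir i)) : TPt 4 (R.cubesPerDir j) := toCube R (i + R.m') j a

/-- [folklore] Unfolding `coarsen`: quotient by `L^{j − i}`. -/
theorem coarsen_apply (i j : ℕ) (a : TPt 4 (R.cubesPerDir i)) (ν : Fin 4) :
    coarsen R i j a ν = (((a ν).val / R.F.L ^ (j - i) : ℕ) : ZMod (R.cubesPerDir j)) := by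
  simp only [coarsen, toCube_apply]
  congr 3
  omega

/-- [folklore] Coarsening to the same level is the identity (the holder's `toCube_self`). -/
@[simp] theorem coarsen_self (i : ℕ) (a : TPt 4 (R.cubesPerDir i)) : coarsen R i i a = a := toCube_self R i a

/-! ## §2 The `InnerData` of record -/

/-- [folklore] The catalogue ONE LEVEL BELOW the output level: `𝐃_{k−1} = R.domAt (k − 1)` for `k ≥ 1`, empty for `k = 0` (no step
has output level `0` below which potentials would live). -/
noncomputable def innerLevel (k : ℕ) : Finset R.carriers.Dom := if 0 < k then R.domAt (k - 1) else ∅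

/-- [folklore] The BONDS INSIDE a domain: the level-`(scale Z₀)` bonds of the holder's `bondsAt Z₀ (scale Z₀)` (source in `Z₀`) whose
target also lies in `Z₀` (`sitesAt`), tagged by their level. -/
noncomputable def bondsIn (Z₀ : R.carriers.Dom) : Finset (Bnd R) :=
  ((bondsAt Z₀ Z₀.1).filter fun b => b.tgt ∈ sitesAt Z₀ Z₀.1).map
    (Function.Embedding.sigmaMk (β := fun i : ℕ => PBond (R.F.P R.K) i) Z₀.1)

/-- [folklore] CROSS-LEVEL INCLUSION: `Y` lies inside `Z` iff `Y`'s level is at most `Z`'s and every cube of `Y`, coarsened to `Z`'s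
level, is a cube of `Z`. -/
def Within (Y Z : R.carriers.Dom) : Prop := Y.1 ≤ Z.1 ∧ Y.2.1.image (coarsen R Y.1 Z.1) ⊆ Z.2.1

/-- [folklore] Cross-level inclusion is decidable. -/
instance decWithin (Y Z : R.carriers.Dom) : Decidable (Within R Y Z) := by
  unfold Within; infer_instance

/-- [folklore] **THE `InnerData` OF RECORD** on the carriers of record. -/
noncomputable def b13InnerData : InnerData R.carriers (Bnd R) where
  innerLevel := innerLevel R
  bondsIn := bondsIn R
  within := Within R

/-! ## §3 Bookkeeping -/

/-- [folklore] The fields of the record, unfolded. -/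
@[simp] theorem b13InnerData_innerLevel (k : ℕ) : (b13InnerData R).innerLevel k = innerLevel R k := rfl

/-- [folklore] The fields of the record, unfolded. -/
@[simp] theorem b13InnerData_bondsIn (Z₀ : R.carriers.Dom) : (b13InnerData R).bondsIn Z₀ = bondsIn R Z₀ := rfl

/-- [folklore] The fields of the record, unfolded. -/
theorem b13InnerData_within (Y Z : R.carriers.Dom) : (b13InnerData R).within Y Z ↔ Within R Y Z := Iff.rfl

/-- [folklore] Membership in the inner catalogue: `Y ∈ innerLevel k ⟺ 0 < k ∧ scale Y + 1 = k`. -/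
theorem mem_innerLevel {k : ℕ} {Y : R.carriers.Dom} : Y ∈ innerLevel R k ↔ 0 < k ∧ R.carriers.scale Y + 1 = k := by
  unfold innerLevel
  split_ifs with hk
  · rw [TwoRuns.mem_domAt]
    constructor
    · intro h; exact ⟨hk, by omega⟩
    · rintro ⟨-, h⟩; omega
  · simp only [Finset.notMem_empty, false_iff, not_and]
    intro h; exact absurd h hk

/-- [folklore] No inner catalogue below output level `0`. -/
@[simp] theorem innerLevel_zero : innerLevel R 0 = ∅ := rfl

/-- [folklore] The inner catalogue of output level `k + 1` is `𝐃_k`. -/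
@[simp] theorem innerLevel_succ (k : ℕ) : innerLevel R (k + 1) = R.domAt k := by
  simp [innerLevel]

/-- [folklore] Membership in `bondsIn Z₀`: a level-`(scale Z₀)` bond with both endpoints in `Z₀`. -/
theorem mem_bondsIn {Z₀ : R.carriers.Dom} {b : Bnd R} :
    b ∈ bondsIn R Z₀ ↔ ∃ c : PBond (R.F.P R.K) Z₀.1, b = ⟨Z₀.1, c⟩ ∧ c.src ∈ sitesAt Z₀ Z₀.1 ∧ c.tgt ∈ sitesAt Z₀ Z₀.1 := by
  simp only [bondsIn, Finset.mem_map, Finset.mem_filter, mem_bondsAt, Function.Embedding.sigmaMk_apply]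
  constructor
  · rintro ⟨c, ⟨h1, h2⟩, rfl⟩; exact ⟨c, rfl, h1, h2⟩
  · rintro ⟨c, rfl, h1, h2⟩; exact ⟨c, ⟨h1, h2⟩, rfl⟩

/-- [folklore] Both endpoints of a bond of `bondsIn Z₀` have their `M`-cube in `Z₀` (the holder's `mem_sitesAt`). -/
theorem toCube_mem_of_mem_bondsIn {Z₀ : R.carriers.Dom} {c : PBond (R.F.P R.K) Z₀.1} (h : (⟨Z₀.1, c⟩ : Bnd R) ∈ bondsIn R Z₀) :
    toCube R Z₀.1 Z₀.1 c.src ∈ Z₀.2.1 ∧ toCube R Z₀.1 Z₀.1 c.tgt ∈ Z₀.2.1 := by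
  obtain ⟨c', hc', h1, h2⟩ := (mem_bondsIn R).1 h
  cases hc'
  exact ⟨(mem_sitesAt Z₀ _).1 h1, (mem_sitesAt Z₀ _).1 h2⟩

/-- [folklore] Every bond of `bondsIn Z₀` is a bond of `Z₀`'s own level. -/
theorem fst_eq_of_mem_bondsIn {Z₀ : R.carriers.Dom} {b : Bnd R} (h : b ∈ bondsIn R Z₀) : b.1 = Z₀.1 := by
  obtain ⟨c, rfl, -, -⟩ := (mem_bondsIn R).1 h
  rfl

/-- [folklore] Unfolding the inclusion. -/
theorem within_iff {Y Z : R.carriers.Dom} :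
    Within R Y Z ↔ Y.1 ≤ Z.1 ∧ Y.2.1.image (coarsen R Y.1 Z.1) ⊆ Z.2.1 := Iff.rfl

/-- [folklore] On ONE level the inclusion is plain inclusion of the cube sets. -/
theorem within_iff_of_fst_eq {Y Z : R.carriers.Dom} (h : Y.1 = Z.1) : Within R Y Z ↔ Y.2.1 ⊆ h ▸ Z.2.1 := by
  obtain ⟨i, Y⟩ := Y
  obtain ⟨j, Z⟩ := Z
  cases h
  simp only [within_iff, le_refl, true_and]
  constructor
  · intro hs a ha
    have := hs (Finset.mem_image_of_mem _ ha)
    rwa [coarsen_self] at this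
  · intro hs a ha
    obtain ⟨a', ha', rfl⟩ := Finset.mem_image.1 ha
    rw [coarsen_self]
    exact hs ha'

/-- [folklore] The inclusion is reflexive. -/
theorem within_refl (Y : R.carriers.Dom) : Within R Y Y :=
  (within_iff_of_fst_eq R rfl).2 subset_rfl

/-- [folklore] The inclusion only goes upward in level. -/
theorem fst_le_of_within {Y Z : R.carriers.Dom} (h : Within R Y Z) : Y.1 ≤ Z.1 := h.1

end Summit.QuantumFields.BalabanUV.T4Continuum.B13InnerData
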